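import Summits.BirchSwinnertonDyer.BirchSwinnertonDyer.Theses.SchneiderFreeAdditiveX3Upper
import Summits.BirchSwinnertonDyer.BirchSwinnertonDyer.Theorems.SchneiderFreeAdditiveX3GordCellRowPrimes
import Summits.BirchSwinnertonDyer.BirchSwinnertonDyer.Theorems.SchneiderFreeAdditiveX3PotMultCellRowPrimes
import HarnessLib

/-!
# Route `SchneiderFreeAdditiveX3Upper` (K1 door, upper wing), cruxes r3 `GordTwoBranchCoIMCField` (item 20365) and r4 `PotMultBranchCoIMC`
# (item 20366): both are VACUOUS off the census primes — r3 BY NAME is the conjunction of its instances at `p ∈ {3, 5, 7, 13, 37}`, r4 of its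
# instances at `p ∈ {3, 5, 7, 13}` (Mazur's theorems displayed)

Cell `bsd-schneider-ideate`, seat `bsd-schneider-door-c5` (prover, generation 35; assembly layer; `--supports` 20365 — record support for the
sibling route, the upper-wing twin of this seat's generation-35 `KYBranchRowPrimes` (crux 19177) and `KYBranchRowPrimesPotMult` (crux 19176)).
PARTITION: board row B6 ∩ X3 ∩ sst-twist, `r = 1`, (G-ord, `e = 2`) half (2 560 pairs) and (M) half (4 541 pairs) of `Rank1Residual.partition` —
ASSEMBLY; types-the-object-of nothing new; closes nothing (BSD NOT advanced).  bears_on: K1-door upper wing (route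
`SchneiderFreeAdditiveX3Upper`, items 20365/20366).

WHY.  Both upper cruxes quantify over every odd prime under `ClassX3 W p` (a rational `p`-isogeny) and the cell predicate (`SubGordTwo`:
`e = 2`; `SubM`: `v_p(j) < 0`).  This seat's generation-35 theorems `KYBranchRowPrimes.mem_rowPrimes_of_classX3_of_subGordTwo` and
`KYBranchRowPrimesPotMult.mem_rowPrimesM_of_classX3_of_subM` (Mazur's Thm. 1 `mazur_isogeny_irreducible` and his `j`-table
`mazur_j_mem_of_not_hasIrreducibleModPGaloisRep_of_eleven_le`, displayed; the two elementary `j`-obstructions against `e = 2`; `p`-integrality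
of the eleven moduli against `v_p(j) < 0`) put the primes of the two rows in `{2, 3, 5, 7, 13, 37}` and `{2, 3, 5, 7, 13}`.  Hence:
* §1 `gordTwoBranchCoIMCField_of_rowPrimes` — item 20365 BY NAME from its OWN instances at `p ∈ {3, 5, 7, 13, 37}`;
* §2 `potMultBranchCoIMC_of_rowPrimes` — item 20366 BY NAME from its OWN instances at `p ∈ {3, 5, 7, 13}`.

HONEST FRAMING: CONDITIONAL on Mazur's two displayed published facts; no definition, no new named fact, no `sorry`; items 20365/20366 stay OPEN
(their mathematics is untouched — only the vacuous primes are discharged); BSD is proved for no curve; «closes rung: none».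
References: Mazur, Invent. Math. 44 (1978) Thm. 1, Thm. 7.1, table p. 129 [Mazur1978]; Lozano-Robledo, Math. Ann. 357 (2013) Table 4
[LozanoRobledo2013MathAnn]; this seat p739034 (F24d), p739345 (F24e).
-/

set_option autoImplicit false
-- `Summit.<P>.<Sub>` repeats `BirchSwinnertonDyer` by the tree's layout convention (D-0017)
set_option linter.dupNamespace false

noncomputable section

open scoped Classical

open WeierstrassCurve Literature.NumberTheory.EllipticCurves Literature.NumberTheory.EllipticCurves.Rank1Residual
  Literature.NumberTheory.EllipticCurves.KellerYin2024
  Summit.BirchSwinnertonDyer.Rank1Residual Summit.BirchSwinnertonDyer.BirchSwinnertonDyer.Theorems.SchneiderFree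

namespace Summit.BirchSwinnertonDyer.BirchSwinnertonDyer.Theorems.SchneiderFreeAdditiveX3.UpperRowPrimes

/-! ### §1 Upper r3 `GordTwoBranchCoIMCField` from its five instances -/

/-- **Item 20365 `GordTwoBranchCoIMCField` BY NAME is the conjunction of its OWN instances at `p ∈ {3, 5, 7, 13, 37}`**: at every other
prime `ClassX3 W p ∧ SubGordTwo W p` is contradictory (`KYBranchRowPrimes.mem_rowPrimes_of_classX3_of_subGordTwo`; `p = 2` is the crux's own
exclusion), so the crux holds VACUOUSLY there.  CONDITIONAL on Mazur's two displayed published facts; nothing is closed; BSD is NOT advanced.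
[cite: Mazur1978, Thm. 1 and table p. 129] [cite: LozanoRobledo2013MathAnn, Table 4] -/
theorem gordTwoBranchCoIMCField_of_rowPrimes (hM : mazur_isogeny_irreducible)
    (hJ : mazur_j_mem_of_not_hasIrreducibleModPGaloisRep_of_eleven_le)
    (h : ∀ (W : WeierstrassCurve ℚ) [W.IsElliptic] [W.IsGloballyMinimal] (p : ℕ) [Fact p.Prime],
      p = 3 ∨ p = 5 ∨ p = 7 ∨ p = 13 ∨ p = 37 → ClassX3 W p → Additive.SubGordTwo W p →
        (∃ Φ : AddSubgroup (WeierstrassCurve.geomTorsion W (p : ℤ)), IsRationalLine W p Φ ∧ ¬ LineDecompositionTrivialAt W p Φ) →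
        ∀ (K : Type) [Field K] [NumberField K], IsImaginaryQuadratic K → NumberField.discr K ≠ -3 →
          Upper.AdditiveIMCUpperBDPInputManinAtField W p K) :
    Summit.BirchSwinnertonDyer.BirchSwinnertonDyer.Theses.SchneiderFreeAdditiveX3Upper.GordTwoBranchCoIMCField := by
  intro W _ _ p _ hp2 hX hS hΦ K _ _ hK hdK
  have hmem := KYBranchRowPrimes.mem_rowPrimes_of_classX3_of_subGordTwo hM hJ W hX hS
  simp only [Finset.mem_insert, Finset.mem_singleton] at hmem
  rcases hmem with h2 | h5
  · exact absurd h2 hp2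
  · exact h W p h5 hX hS hΦ K hK hdK

/-! ### §2 Upper r4 `PotMultBranchCoIMC` from its four instances -/

/-- **Item 20366 `PotMultBranchCoIMC` BY NAME is the conjunction of its OWN instances at `p ∈ {3, 5, 7, 13}`**: at every other prime
`ClassX3 W p ∧ SubM W p` is contradictory (`KYBranchRowPrimesPotMult.mem_rowPrimesM_of_classX3_of_subM`: Mazur's eleven moduli are
`p`-integral).  CONDITIONAL on Mazur's two displayed published facts; nothing is closed; BSD is NOT advanced.
[cite: Mazur1978, Thm. 1 and table p. 129] [cite: LozanoRobledo2013MathAnn, Table 4] -/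
theorem potMultBranchCoIMC_of_rowPrimes (hM : mazur_isogeny_irreducible)
    (hJ : mazur_j_mem_of_not_hasIrreducibleModPGaloisRep_of_eleven_le)
    (h : ∀ (W : WeierstrassCurve ℚ) [W.IsElliptic] [W.IsGloballyMinimal] (p : ℕ) [Fact p.Prime],
      p = 3 ∨ p = 5 ∨ p = 7 ∨ p = 13 → ClassX3 W p → Additive.SubM W p →
        (∃ Φ : AddSubgroup (WeierstrassCurve.geomTorsion W (p : ℤ)), IsRationalLine W p Φ ∧ ¬ LineDecompositionTrivialAt W p Φ) →
        Upper.AdditiveIMCUpperBDPInputManinAt W p) :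
    Summit.BirchSwinnertonDyer.BirchSwinnertonDyer.Theses.SchneiderFreeAdditiveX3Upper.PotMultBranchCoIMC := by
  intro W _ _ p _ hp2 hX hS hΦ
  have hmem := KYBranchRowPrimesPotMult.mem_rowPrimesM_of_classX3_of_subM hM hJ W hX hS
  simp only [Finset.mem_insert, Finset.mem_singleton] at hmem
  rcases hmem with h2 | h4
  · exact absurd h2 hp2
  · exact h W p h4 hX hS hΦ

end Summit.BirchSwinnertonDyer.BirchSwinnertonDyer.Theorems.SchneiderFreeAdditiveX3.UpperRowPrimes

end
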